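import Summits.AtomisticToContinuum.Crystallization.Theses.PerronTransitivity
import Summits.AtomisticToContinuum.Crystallization.Theorems.ChargedEnergyGap.Negative.Unconditional
import Literature.MathematicalPhysics.StatisticalMechanics.Yuhjtman2015Stability

/-!
# Negative knowledge for crux `PerronTransitivity.TransitiveLocalLimit` (stmt-AtomisticToContinuum-15100), II:
# the open stub `stub_superBoundSparse` of the registered line `birth` is FALSE without minimality

Refuter vetting (cdisprove, `--supports stmt-AtomisticToContinuum-15100`). The only open stub of the line
`Cruxes/TransitiveLocalLimit/Lines/birth.lean` is

  `stub_superBoundSparse : ∀ x, (∀ N, IsGroundState V_LJ (x N)) → ∀ θ > 0,`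
  `  #{i : 𝓔ⁱ(x N) ≤ 2E* − θ} / N → 0`        (`𝓔ⁱ = siteEnergy`, `E* = ⨅_Q e_LJ(Q)`),

"no density of `θ`-super-bound sites along Lennard-Jones ground states".

* `neg_le_two_mul_iInf` — `−14.316/6 ≤ 2E*` (Yuhjtman's stability constant `Yuhjtman2015_stabilityConstant_holds`
  and the proved `crysEnergyLimit`), so "`θ`-super-bound" is a non-vacuous, explicit threshold: `2E* − θ ≥ −2.386 − θ`.
* `stub_superBoundSparse_false_without_minimality` — with `IsGroundState` weakened to injectivity the stub is
  FALSE. Witness: the HEDGEHOG configurations `hedge` — clusters of `37` particles, a centre plus `36` spikes at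
  distance exactly `1` from it (rational points `((1−t²)/(1+t²), 2t/(1+t²), 0)`, `t = 1,…,36`, of the unit circle),
  consecutive clusters `4` apart along `e₂`; every centre has `𝓔 ≤ 36·V_LJ(1) = −3 ≤ 2E* − 1/2` (all other
  particles are at distance `≥ 1`, where `V_LJ ≤ 0`), and centres have density `1/37` along `N = 37m`.
  So the stub's content is entirely in the minimality of ground states (super-bound sites exist in abundance in
  injective configurations; the stub bets a GROUND STATE cannot afford a positive density of them).
All `[folklore]`.
-/

noncomputable section

namespace Summit.AtomisticToContinuum.Crystallization.Theorems.TransitiveLocalLimit.Negative.StubSuperBoundSparse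

open Filter
open Literature.MathematicalPhysics.StatisticalMechanics
open Summit.AtomisticToContinuum.Crystallization.Theorems.ChargedEnergyGapNegative (crysEnergyLimit)

/-! ## The threshold is explicit: `2E* ≥ −14.316/6` -/

/-- `−14.316/12 ≤ E* = ⨅_Q e_LJ(Q)`: `E(N) ≥ −(14.316/12)·N` (Yuhjtman 2015, Thm. 9, proved in tree) and
`E(N)/N → E*` (`crysEnergyLimit`). [cite: Yuhjtman2015, Thm. 9] -/
theorem neg_le_iInf :
    -(14.316 / 12 : ℝ) ≤ ⨅ Q : PeriodicConfiguration 3, Q.energyPerParticle lennardJones := by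
  refine ge_of_tendsto crysEnergyLimit (Filter.eventually_atTop.2 ⟨1, fun N hN => ?_⟩)
  have hN' : (0 : ℝ) < N := by exact_mod_cast hN
  have h := Yuhjtman2015_stabilityConstant_holds.groundStateEnergy_ge N
  rw [le_div_iff₀ hN']
  linarith

/-- Hence `−14.316/6 ≤ 2E*`. [cite: Yuhjtman2015, Thm. 9] -/
theorem neg_le_two_mul_iInf :
    -(14.316 / 6 : ℝ) ≤ 2 * ⨅ Q : PeriodicConfiguration 3, Q.energyPerParticle lennardJones := by
  have := neg_le_iInf
  linarith

/-! ## The hedgehog witness -/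

/-- Spike direction `k`: the rational point of the unit circle with parameter `t = k + 1`. -/
def spikeDir (k : ℕ) : EuclideanSpace ℝ (Fin 3) :=
  !₂[(1 - ((k : ℝ) + 1) ^ 2) / (1 + ((k : ℝ) + 1) ^ 2), 2 * ((k : ℝ) + 1) / (1 + ((k : ℝ) + 1) ^ 2), 0]

/-- First coordinate of a spike. [folklore] -/
@[simp] theorem spikeDir_apply_zero (k : ℕ) :
    spikeDir k 0 = (1 - ((k : ℝ) + 1) ^ 2) / (1 + ((k : ℝ) + 1) ^ 2) := by
  simp [spikeDir]

/-- Second coordinate of a spike. [folklore] -/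
@[simp] theorem spikeDir_apply_one (k : ℕ) :
    spikeDir k 1 = 2 * ((k : ℝ) + 1) / (1 + ((k : ℝ) + 1) ^ 2) := by
  simp [spikeDir]

/-- Third coordinate of a spike vanishes. [folklore] -/
@[simp] theorem spikeDir_apply_two (k : ℕ) : spikeDir k 2 = 0 := by
  simp [spikeDir]

/-- Spikes have unit length. [folklore] -/
theorem norm_spikeDir (k : ℕ) : ‖spikeDir k‖ = 1 := by
  rw [EuclideanSpace.norm_eq, Fin.sum_univ_three, spikeDir_apply_zero, spikeDir_apply_one,
    spikeDir_apply_two, Real.sqrt_eq_one]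
  simp only [Real.norm_eq_abs, sq_abs, abs_zero]
  have ht : (0 : ℝ) < 1 + ((k : ℝ) + 1) ^ 2 := by positivity
  field_simp
  ring

/-- The second coordinate `2t/(1+t²)` of the spikes is strictly decreasing in `t ≥ 1`. [folklore] -/
theorem spikeDir_one_strictAnti :
    StrictAnti fun k : ℕ => 2 * ((k : ℝ) + 1) / (1 + ((k : ℝ) + 1) ^ 2) := by
  refine strictAnti_nat_of_succ_lt fun k => ?_
  push_cast
  rw [div_lt_div_iff₀ (by positivity) (by positivity)]
  nlinarith [sq_nonneg ((k : ℝ) + 1), (k.cast_nonneg : (0 : ℝ) ≤ k)]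

/-- Distinct parameters give distinct spikes. [folklore] -/
theorem spikeDir_injective : Function.Injective spikeDir := fun k l h =>
  spikeDir_one_strictAnti.injective (by simpa using congrArg (fun v : EuclideanSpace ℝ (Fin 3) => v 1) h)

/-- Slot positions inside a cluster: slot `0` is the centre, slot `k + 1` the spike `k`. -/
def slotPos : ℕ → EuclideanSpace ℝ (Fin 3)
  | 0 => 0
  | k + 1 => spikeDir k

/-- Slots have norm `≤ 1`. [folklore] -/
theorem norm_slotPos_le (s : ℕ) : ‖slotPos s‖ ≤ 1 := by
  cases s with
  | zero => simp [slotPos]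
  | succ k => simp [slotPos, norm_spikeDir]

/-- Slots have vanishing third coordinate. [folklore] -/
theorem slotPos_apply_two (s : ℕ) : slotPos s 2 = 0 := by
  cases s with
  | zero => simp [slotPos]
  | succ k => simp [slotPos]

/-- Distinct slots are distinct points (the centre has norm `0`, spikes norm `1`). [folklore] -/
theorem slotPos_injective : Function.Injective slotPos := by
  intro a b h
  cases a with
  | zero =>
    cases b with
    | zero => rfl
    | succ l =>
      exfalso
      have := congrArg (fun v : EuclideanSpace ℝ (Fin 3) => ‖v‖) h
      simp [slotPos, norm_spikeDir] at this
  | succ k =>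
    cases b with
    | zero =>
      exfalso
      have := congrArg (fun v : EuclideanSpace ℝ (Fin 3) => ‖v‖) h
      simp [slotPos, norm_spikeDir] at this
    | succ l =>
      have hkl : k = l := spikeDir_injective h
      rw [hkl]

/-- Position of particle number `n`: cluster `n / 37` sits at `4·(n/37)·e₂`, slot `n % 37`. -/
def hedgePos (n : ℕ) : EuclideanSpace ℝ (Fin 3) :=
  (4 * ((n / 37 : ℕ) : ℝ)) • EuclideanSpace.single (2 : Fin 3) (1 : ℝ) + slotPos (n % 37)

/-- The hedgehog configurations: the same positions for every `N`. -/
def hedge (N : ℕ) (i : Fin N) : EuclideanSpace ℝ (Fin 3) := hedgePos i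

/-- Third coordinate of a position is `4·(cluster index)`. [folklore] -/
theorem hedgePos_apply_two (n : ℕ) : hedgePos n 2 = 4 * ((n / 37 : ℕ) : ℝ) := by
  simp [hedgePos, slotPos_apply_two]

/-- The positions are pairwise distinct. [folklore] -/
theorem hedgePos_injective : Function.Injective hedgePos := by
  intro n m h
  have h2 := congrArg (fun v : EuclideanSpace ℝ (Fin 3) => v 2) h
  simp only [hedgePos_apply_two] at h2
  have hq' : ((n / 37 : ℕ) : ℝ) = ((m / 37 : ℕ) : ℝ) := by linarith
  have hq : n / 37 = m / 37 := by exact_mod_cast hq'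
  have hs : slotPos (n % 37) = slotPos (m % 37) := by
    have h' := h
    unfold hedgePos at h'
    rw [hq] at h'
    exact add_left_cancel h'
  have hs' : n % 37 = m % 37 := slotPos_injective hs
  omega

/-- Each `hedge N` is a configuration of distinct points. [folklore] -/
theorem hedge_injective (N : ℕ) : Function.Injective (hedge N) := fun _ _ h =>
  Fin.ext (hedgePos_injective h)

/-- Centre of cluster `q`. [folklore] -/
theorem hedgePos_centre (q : ℕ) :
    hedgePos (37 * q) = (4 * (q : ℝ)) • EuclideanSpace.single (2 : Fin 3) (1 : ℝ) := by
  have h1 : 37 * q / 37 = q := by omega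
  have h2 : 37 * q % 37 = 0 := by omega
  simp [hedgePos, h1, h2, slotPos]

/-- Spike `k` of cluster `q`. [folklore] -/
theorem hedgePos_spike (q k : ℕ) (hk : k < 36) :
    hedgePos (37 * q + (k + 1)) = (4 * (q : ℝ)) • EuclideanSpace.single (2 : Fin 3) (1 : ℝ) + spikeDir k := by
  have h1 : (37 * q + (k + 1)) / 37 = q := by omega
  have h2 : (37 * q + (k + 1)) % 37 = k + 1 := by omega
  simp [hedgePos, h1, h2, slotPos]

/-- A centre and its own spikes are at distance exactly `1`. [folklore] -/
theorem dist_centre_spike (q k : ℕ) (hk : k < 36) :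
    dist (hedgePos (37 * q)) (hedgePos (37 * q + (k + 1))) = 1 := by
  rw [hedgePos_centre, hedgePos_spike q k hk, dist_eq_norm, sub_add_eq_sub_sub, sub_self, zero_sub,
    norm_neg, norm_spikeDir]

/-- Every other particle is at distance `≥ 1` from a centre (own spikes: exactly `1`; other clusters: their
third coordinates differ by `≥ 4` while slots have norm `≤ 1`). [folklore] -/
theorem one_le_dist_centre (q n : ℕ) (hn : n ≠ 37 * q) : 1 ≤ dist (hedgePos (37 * q)) (hedgePos n) := by
  by_cases hq : n / 37 = q
  · obtain ⟨k, hk, rfl⟩ : ∃ k, k < 36 ∧ n = 37 * q + (k + 1) := ⟨n % 37 - 1, by omega, by omega⟩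
    rw [dist_centre_spike q k hk]
  · rw [hedgePos_centre, dist_eq_norm]
    unfold hedgePos
    set e₂ : EuclideanSpace ℝ (Fin 3) := EuclideanSpace.single (2 : Fin 3) (1 : ℝ) with he₂
    have hrw : (4 * (q : ℝ)) • e₂ - ((4 * ((n / 37 : ℕ) : ℝ)) • e₂ + slotPos (n % 37)) =
        (4 * (q : ℝ) - 4 * ((n / 37 : ℕ) : ℝ)) • e₂ - slotPos (n % 37) := by
      rw [sub_smul]; abel
    rw [hrw]
    have h1 : ‖(4 * (q : ℝ) - 4 * ((n / 37 : ℕ) : ℝ)) • e₂‖ = |4 * (q : ℝ) - 4 * ((n / 37 : ℕ) : ℝ)| := by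
      rw [norm_smul, he₂, PiLp.norm_single, norm_one, mul_one, Real.norm_eq_abs]
    have h2 : (4 : ℝ) ≤ |4 * (q : ℝ) - 4 * ((n / 37 : ℕ) : ℝ)| := by
      rw [← mul_sub, abs_mul, abs_of_pos four_pos]
      have : (1 : ℝ) ≤ |(q : ℝ) - ((n / 37 : ℕ) : ℝ)| := by
        rcases lt_or_gt_of_ne hq with h | h
        · have h' : ((n / 37 : ℕ) : ℝ) + 1 ≤ (q : ℝ) := by exact_mod_cast h
          rw [abs_of_nonneg (by linarith)]
          linarith
        · have h' : (q : ℝ) + 1 ≤ ((n / 37 : ℕ) : ℝ) := by exact_mod_cast h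
          rw [abs_of_nonpos (by linarith)]
          linarith
      linarith
    have h3 := norm_sub_norm_le ((4 * (q : ℝ) - 4 * ((n / 37 : ℕ) : ℝ)) • e₂) (slotPos (n % 37))
    have h4 := norm_slotPos_le (n % 37)
    linarith

/-- **Every centre is bound at least `−3`** (its `36` spikes give `36·V_LJ(1) = −3`, all other terms are `≤ 0`).
[folklore] -/
theorem siteEnergy_centre_le {N q : ℕ} (hq : 37 * q + 36 < N) :
    siteEnergy lennardJones (hedge N) ⟨37 * q, by omega⟩ ≤ -3 := by
  unfold siteEnergy
  set i₀ : Fin N := ⟨37 * q, by omega⟩ with hi₀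
  let emb : Fin 36 ↪ Fin N :=
    ⟨fun j => ⟨37 * q + ((j : ℕ) + 1), by omega⟩, fun j j' h => by
      simp only [Fin.mk.injEq] at h
      exact Fin.ext (by omega)⟩
  set S : Finset (Fin N) := Finset.univ.map emb with hS_def
  have hS : S ⊆ Finset.univ.erase i₀ := by
    intro k hk
    rw [Finset.mem_erase]
    refine ⟨?_, Finset.mem_univ _⟩
    obtain ⟨j, -, rfl⟩ := Finset.mem_map.1 hk
    intro h
    have h' := congrArg Fin.val h
    simp [emb, hi₀] at h'
  have hnonpos : ∀ k ∈ Finset.univ.erase i₀, k ∉ S →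
      lennardJones (dist (hedge N i₀) (hedge N k)) ≤ 0 := by
    intro k hk _
    have hk' : (k : ℕ) ≠ 37 * q := fun h => (Finset.ne_of_mem_erase hk) (Fin.ext h)
    exact lennardJones_nonpos (one_le_dist_centre q k hk')
  have hval : ∀ j : Fin 36, lennardJones (dist (hedge N i₀) (hedge N (emb j))) = -1 / 12 := by
    intro j
    show lennardJones (dist (hedgePos (37 * q)) (hedgePos (37 * q + ((j : ℕ) + 1)))) = _
    rw [dist_centre_spike q j j.isLt, lennardJones_one]
  calc ∑ k ∈ Finset.univ.erase i₀, lennardJones (dist (hedge N i₀) (hedge N k))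
      ≤ ∑ k ∈ S, lennardJones (dist (hedge N i₀) (hedge N k)) := by
        have key := Finset.sum_le_sum_of_subset_of_nonneg hS
          (f := fun k => -lennardJones (dist (hedge N i₀) (hedge N k)))
          (fun k hk hkS => neg_nonneg.2 (hnonpos k hk hkS))
        simp only [Finset.sum_neg_distrib] at key
        linarith
    _ = ∑ j : Fin 36, lennardJones (dist (hedge N i₀) (hedge N (emb j))) := Finset.sum_map _ _ _
    _ = ∑ _j : Fin 36, (-1 / 12 : ℝ) := Finset.sum_congr rfl fun j _ => hval j
    _ = -3 := by simp only [Finset.sum_const, Finset.card_univ, Fintype.card_fin, nsmul_eq_mul]; norm_num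

/-- Along `N = 37m` the `(1/2)`-super-bound sites number at least `m` (every centre qualifies, as
`−3 ≤ 2E* − 1/2`). [folklore] -/
theorem le_card_superBound (m : ℕ) :
    (m : ℝ) ≤ ((Finset.univ.filter fun i : Fin (37 * m) =>
      siteEnergy lennardJones (hedge (37 * m)) i ≤
        2 * (⨅ Q : PeriodicConfiguration 3, Q.energyPerParticle lennardJones) - 1 / 2).card : ℝ) := by
  let cen : Fin m ↪ Fin (37 * m) :=
    ⟨fun q => ⟨37 * (q : ℕ), by omega⟩, fun q q' h => by
      simp only [Fin.mk.injEq] at h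
      exact Fin.ext (by omega)⟩
  have hsub : Finset.univ.map cen ⊆ Finset.univ.filter fun i : Fin (37 * m) =>
      siteEnergy lennardJones (hedge (37 * m)) i ≤
        2 * (⨅ Q : PeriodicConfiguration 3, Q.energyPerParticle lennardJones) - 1 / 2 := by
    intro i hi
    obtain ⟨q, -, rfl⟩ := Finset.mem_map.1 hi
    rw [Finset.mem_filter]
    refine ⟨Finset.mem_univ _, ?_⟩
    have h1 := siteEnergy_centre_le (N := 37 * m) (q := q) (by omega)
    have h2 := neg_le_two_mul_iInf
    show siteEnergy lennardJones (hedge (37 * m)) ⟨37 * (q : ℕ), _⟩ ≤ _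
    linarith
  have h := Finset.card_le_card hsub
  rw [Finset.card_map, Finset.card_univ, Fintype.card_fin] at h
  exact_mod_cast h

/-! ## Minimality is load-bearing for the stub -/

/-- **`stub_superBoundSparse` is FALSE without energy minimality**: for the (injective) hedgehog configurations
the density of `(1/2)`-super-bound sites is `≥ 1/37` along `N = 37m`, so it does not tend to `0`. Any proof of
the stub must use that the `x N` are minimisers. [folklore] -/
theorem stub_superBoundSparse_false_without_minimality :
    ¬ (∀ x : (N : ℕ) → (Fin N → EuclideanSpace ℝ (Fin 3)), (∀ N, Function.Injective (x N)) →
        ∀ θ : ℝ, 0 < θ → Filter.Tendsto (fun N : ℕ => ((Finset.univ.filter fun i : Fin N =>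
          Literature.MathematicalPhysics.StatisticalMechanics.siteEnergy
            Literature.MathematicalPhysics.StatisticalMechanics.lennardJones (x N) i ≤
            2 * (⨅ Q : Literature.MathematicalPhysics.StatisticalMechanics.PeriodicConfiguration 3,
              Q.energyPerParticle Literature.MathematicalPhysics.StatisticalMechanics.lennardJones) - θ).card : ℝ) / N)
          Filter.atTop (nhds 0)) := by
  intro h
  have ht := h hedge hedge_injective (1 / 2) one_half_pos
  have hev := ht.eventually (gt_mem_nhds (show (0 : ℝ) < 1 / 37 by norm_num))
  obtain ⟨N₀, hN₀⟩ := Filter.eventually_atTop.1 hev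
  have hlt := hN₀ (37 * (N₀ + 1)) (by omega)
  have hge := le_card_superBound (N₀ + 1)
  have hpos : (0 : ℝ) < ((37 * (N₀ + 1) : ℕ) : ℝ) := by positivity
  rw [div_lt_iff₀ hpos] at hlt
  push_cast at hlt hge
  linarith

end Summit.AtomisticToContinuum.Crystallization.Theorems.TransitiveLocalLimit.Negative.StubSuperBoundSparse

end
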